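import Summits.CriticalPhenomena.SAWScalingLimit.Theses.SAWQuadrupoleWard
import Literature.Probability.RandomPlanarGeometry.SAWRestrictionCovariance
import Literature.Probability.RandomPlanarGeometry.DiagonalDressedSAW
import Literature.Probability.RandomPlanarGeometry.SAWScalingLimitFamily
import Summits.CriticalPhenomena.SAWScalingLimit.Theorems.SAWCircleScreeningScreeningRecursionLawReal

/-!
# `ExactRestriction` PROVED — the deterministic piece of the split of `BoundaryWard` (stmt-CriticalPhenomena-6556)

The support child `ExactRestriction` of the crux-strategist's split (statement literal below, =
`children.json` / `Lines/collar_step_telescoping.lean` §1 / `PieceSkeletons.lean` §0): for the flow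
data of `BoundaryWard`, every bounded continuous `f`, `s ∈ [0, t₀]`, `h > 0`, `s + h ≤ t₀`,
eventually as `δ → 0⁺` the critical SAW law of `(g_s D)_δ` is a probability measure and
`E_{(g_{s+h} D)_δ}[f] · P_{(g_s D)_δ}(Conf) = ∫_{Conf} f d law_{(g_s D)_δ}`, `Conf` = "the walk of
`(g_s D)_δ` has the support of a walk of `(g_{s+h} D)_δ`".

Proof = the three stubs of `PieceSkeletons.lean` §1, all proved here:
* `flowNesting` — `g_{s+h}(D) ⊆ g_s(D)`: the trajectories `r ↦ g_{h+r}(z)` and `r ↦ g_r(g_h z)`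
  solve the same ODE in `D ⊆` a closed ball on which the `C²` field is Lipschitz
  (`Convex.lipschitzOnWith_of_nnnorm_fderiv_le`), so they agree (`ODE_solution_unique_of_mem_Icc_right`);
* `walkNesting` — set nesting + start vertex in the largest component (or a trivial walk) ⇒ every
  SAW of `Ω'_δ` is a SAW of `Ω_δ` with the same support (induction on the walk;
  `mem_meshDomain_of_adj` of `SAWScalingLimitFamily.lean`);
* `restrictionIntegral` — walk nesting ⇒ normalisation (`isProbabilityMeasure_law_of_reachable`)
  and the integral identity, from the partition-function form
  `SAW.law_setOf_exists_support_eq_eq` (`SAWRestrictionCovariance.lean`) by re-indexing the finite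
  sums along the support-preserving injection `DomainSAW Ω' ↪ DomainSAW Ω`.

Sorry-free; axioms standard. A prover lands it as
`Theorems/SAWQuadrupoleWardBoundaryWardExactRestriction.lean` (`--workitem` the child item once the
split is applied, or `--supports stmt-CriticalPhenomena-6556` as `stub_exactRestriction` of the line).
-/

namespace Summit.CriticalPhenomena.SAWScalingLimit.Cruxes.BoundaryWard.ExactRestrictionProof

open MeasureTheory Filter Set
open scoped Topology ENNReal
open Literature.Probability.LatticeModels Literature.Probability.RandomPlanarGeometry
open Literature.Probability.RandomPlanarGeometry.SAW
open Summit.CriticalPhenomena.SAWScalingLimit.Theorems.ScreeningRecursion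

/-! ## Walk nesting -/

/-- A walk of `Ω'_δ` starting in the discrete domain `Ω_δ ⊇` (as sets `Ω' ⊆ Ω`) is, with the same
support, a walk of `Ω_δ`. [folklore] -/
theorem exists_walk_support_eq_of_subset {Ω Ω' : Set ℂ} {δ : ℝ} (hsub : Ω' ⊆ Ω) {v w : Site 2}
    (p : (discreteDomainGraph Ω' δ).Walk v w) (hv : v ∈ meshDomain Ω δ) :
    ∃ q : (discreteDomainGraph Ω δ).Walk v w, q.support = p.support := by
  induction p with
  | nil => exact ⟨SimpleGraph.Walk.nil, rfl⟩
  | @cons v v₁ w hadj p ih =>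
    obtain ⟨hmesh', -, hv₁D'⟩ := discreteDomainGraph_adj_iff.1 hadj
    obtain ⟨hzd, hseg⟩ := meshGraph_adj_iff.1 hmesh'
    have hmesh : (meshGraph Ω δ).Adj v v₁ :=
      meshGraph_adj_iff.2 ⟨hzd, hseg.trans (closure_mono hsub)⟩
    have hvV : v ∈ meshVertices Ω δ := meshDomain_subset_meshVertices _ _ hv
    have hv₁V : v₁ ∈ meshVertices Ω δ := by
      have h := meshDomain_subset_meshVertices _ _ hv₁D'
      rw [mem_meshVertices_iff] at h ⊢
      exact hsub h
    have hv₁ : v₁ ∈ meshDomain Ω δ :=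
      mem_meshDomain_of_adj (u := ⟨v, hvV⟩) (w := ⟨v₁, hv₁V⟩) hv
        (by simpa only [SimpleGraph.comap_adj, Function.Embedding.subtype_apply] using hmesh)
    obtain ⟨q, hq⟩ := ih hv₁
    exact ⟨SimpleGraph.Walk.cons (discreteDomainGraph_adj_iff.2 ⟨hmesh, hv, hv₁⟩) q, by
      rw [SimpleGraph.Walk.support_cons, SimpleGraph.Walk.support_cons, hq]⟩

/-- **Walk nesting** (stub R2 of `PieceSkeletons.lean`, PROVED). [folklore] -/
theorem walkNesting :
    ∀ (Ω Ω' : Set ℂ) (δ : ℝ) (x y : Literature.Probability.LatticeModels.Site 2), Ω' ⊆ Ω → (x ∈ Literature.Probability.LatticeModels.meshDomain Ω δ ∨ x = y) → ∀ γ' : Literature.Probability.RandomPlanarGeometry.SAW.DomainSAW Ω' δ x y, ∃ γ : Literature.Probability.RandomPlanarGeometry.SAW.DomainSAW Ω δ x y, γ.walk.support = γ'.walk.support := by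
  intro Ω Ω' δ x y hsub hx γ'
  rcases hx with hx | hxy
  · obtain ⟨q, hq⟩ := exists_walk_support_eq_of_subset hsub γ'.walk hx
    refine ⟨⟨q, ?_⟩, hq⟩
    rw [SimpleGraph.Walk.isPath_def, hq, ← SimpleGraph.Walk.isPath_def]
    exact γ'.isPath
  · subst hxy
    obtain ⟨p, hp⟩ := γ'
    cases p with
    | nil => exact ⟨⟨SimpleGraph.Walk.nil, SimpleGraph.Walk.IsPath.nil⟩, rfl⟩
    | cons hadj q =>
      exfalso
      rw [SimpleGraph.Walk.cons_isPath_iff] at hp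
      exact hp.2 (SimpleGraph.Walk.end_mem_support q)

/-! ## The integral restriction identity -/

/-- **Integral form of exact restriction** (stub R3 of `PieceSkeletons.lean`, PROVED): under walk
nesting, for bounded `Ω`, `δ > 0` and joined endpoints, `law Ω_δ` is a probability measure and
`E_{Ω'}[f] · P_Ω(Conf) = ∫_{Conf} f dP_Ω`. [cite: LawlerSchrammWerner2004SAW, §3.4.5] -/
theorem restrictionIntegral :
    ∀ (Ω Ω' : Set ℂ) (δ : ℝ) (x y : Literature.Probability.LatticeModels.Site 2), Bornology.IsBounded Ω → 0 < δ → (Literature.Probability.LatticeModels.discreteDomainGraph Ω δ).Reachable x y → (∀ γ' : Literature.Probability.RandomPlanarGeometry.SAW.DomainSAW Ω' δ x y, ∃ γ : Literature.Probability.RandomPlanarGeometry.SAW.DomainSAW Ω δ x y, γ.walk.support = γ'.walk.support) → ∀ f : BoundedContinuousFunction (Literature.Probability.RandomPlanarGeometry.CurveClass ℂ) ℝ, MeasureTheory.IsProbabilityMeasure (Literature.Probability.RandomPlanarGeometry.SAW.law Ω δ x y) ∧ (∫ γ, f γ.curve ∂(Literature.Probability.RandomPlanarGeometry.SAW.law Ω'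 δ x y)) * ((Literature.Probability.RandomPlanarGeometry.SAW.law Ω δ x y) {γ | ∃ γ' : Literature.Probability.RandomPlanarGeometry.SAW.DomainSAW Ω' δ x y, γ'.walk.support = γ.walk.support}).toReal = ∫ γ in {γ | ∃ γ' : Literature.Probability.RandomPlanarGeometry.SAW.DomainSAW Ω' δ x y, γ'.walk.support = γ.walk.support}, f γ.curve ∂(Literature.Probability.RandomPlanarGeometry.SAW.law Ω δ x y) := by
  intro Ω Ω' δ x y hbdd hδ hreach hN f
  haveI hprob : IsProbabilityMeasure (law Ω δ x y) :=
    isProbabilityMeasure_law_of_reachable hbdd hδ hreach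
  refine ⟨hprob, ?_⟩
  classical
  -- finiteness of both walk spaces; discrete measurability
  haveI : Finite (DomainSAW Ω δ x y) := SAW.finite_domainSAW hbdd hδ x y
  choose ι hι using hN
  have hN' : ∀ γ' : DomainSAW Ω' δ x y, ∃ γ : DomainSAW Ω δ x y,
      γ.walk.support = γ'.walk.support := fun γ' => ⟨ι γ', hι γ'⟩
  have hιinj : Function.Injective ι := fun γ₁ γ₂ h =>
    DomainSAW.ext_support (by rw [← hι γ₁, ← hι γ₂, h])
  haveI : Finite (DomainSAW Ω' δ x y) := Finite.of_injective ι hιinj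
  letI : Fintype (DomainSAW Ω δ x y) := Fintype.ofFinite _
  letI : Fintype (DomainSAW Ω' δ x y) := Fintype.ofFinite _
  haveI : MeasurableSingletonClass (DomainSAW Ω δ x y) :=
    ⟨fun _ => MeasurableSpace.measurableSet_top⟩
  haveI : MeasurableSingletonClass (DomainSAW Ω' δ x y) :=
    ⟨fun _ => MeasurableSpace.measurableSet_top⟩
  haveI : IsFiniteMeasure (law Ω' δ x y) :=
    ⟨(law_apply_le_one _).trans_lt ENNReal.one_lt_top⟩
  -- partition functions
  set Z := weight Ω δ x y univ with hZ
  set Z' := weight Ω' δ x y univ with hZ'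
  have hZtop : Z ≠ ⊤ := weight_univ_ne_top hbdd hδ x y
  have hZ'le : Z' ≤ Z := weight_univ_le_weight_univ hN'
  have hZ'top : Z' ≠ ⊤ := ne_top_of_le_ne_top hZtop hZ'le
  -- the confinement event is the range of ι
  set Cf : Set (DomainSAW Ω δ x y) :=
    {γ | ∃ γ' : DomainSAW Ω' δ x y, γ'.walk.support = γ.walk.support} with hCf
  have hCflaw : law Ω δ x y Cf = Z⁻¹ * Z' := law_setOf_exists_support_eq_eq hN'
  have hmemCf : ∀ γ, γ ∈ Cf ↔ ∃ γ', ι γ' = γ := by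
    intro γ
    constructor
    · rintro ⟨γ', h⟩
      exact ⟨γ', DomainSAW.ext_support (by rw [hι γ', h])⟩
    · rintro ⟨γ', rfl⟩
      exact ⟨γ', (hι γ').symm⟩
  -- curves and lengths agree along ι
  have hcurve : ∀ γ', (ι γ').curve = γ'.curve := by
    intro γ'
    show CurveClass.mk _ = CurveClass.mk _
    rw [DomainSAW.toCurve_eq_of_support_eq (hι γ')]
  have hlen : ∀ γ', (ι γ').length = γ'.length := fun γ' =>
    DomainSAW.length_eq_of_support_eq (hι γ')
  -- point masses
  have hptΩ : ∀ γ : DomainSAW Ω δ x y,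
      law Ω δ x y {γ} = Z⁻¹ * ENNReal.ofReal (criticalFugacity ^ γ.length) := fun γ => by
    rw [law_apply_eq_inv_mul_weight, weight_singleton]
  have hptΩ' : ∀ γ' : DomainSAW Ω' δ x y,
      law Ω' δ x y {γ'} = Z'⁻¹ * ENNReal.ofReal (criticalFugacity ^ γ'.length) := fun γ' => by
    rw [law_apply_eq_inv_mul_weight, weight_singleton]
  -- both integrals as finite sums
  have hI' : ∫ γ', f γ'.curve ∂(law Ω' δ x y) =
      ∑ γ', (law Ω' δ x y {γ'}).toReal * f γ'.curve := by
    rw [integral_fintype Integrable.of_finite]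
    simp only [smul_eq_mul, measureReal_def]
  have hI : ∫ γ in Cf, f γ.curve ∂(law Ω δ x y) =
      ∑ γ, ((law Ω δ x y).restrict Cf {γ}).toReal * f γ.curve := by
    rw [integral_fintype Integrable.of_finite]
    simp only [smul_eq_mul, measureReal_def]
  rw [hI', hI, hCflaw]
  -- restrict to the range of ι
  have hrestr : ∀ γ, ((law Ω δ x y).restrict Cf {γ}).toReal * f γ.curve =
      if γ ∈ Cf then (law Ω δ x y {γ}).toReal * f γ.curve else 0 := by
    intro γ
    rw [Measure.restrict_apply (MeasurableSpace.measurableSet_top)]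
    by_cases h : γ ∈ Cf
    · rw [if_pos h, Set.inter_eq_left.2 (Set.singleton_subset_iff.2 h)]
    · rw [if_neg h, Set.singleton_inter_eq_empty.2 h, measure_empty, ENNReal.toReal_zero,
        zero_mul]
  simp_rw [hrestr]
  rw [← Finset.sum_filter]
  have hfilter : (Finset.univ.filter fun γ => γ ∈ Cf) = Finset.univ.image ι := by
    ext γ
    simp only [Finset.mem_filter, Finset.mem_univ, true_and, Finset.mem_image, hmemCf]
  rw [hfilter, Finset.sum_image (fun γ₁ _ γ₂ _ h => hιinj h), Finset.sum_mul]
  refine Finset.sum_congr rfl fun γ' _ => ?_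
  rw [hptΩ', hptΩ, hlen, hcurve]
  -- the scalar identity `(Z'⁻¹ w) · (Z⁻¹ Z') = Z⁻¹ w` (or both sides `0` when `Z' = 0`)
  rcases eq_or_ne Z' 0 with hZ'0 | hZ'0
  · -- then the small walk space is empty: `γ'` cannot exist
    exfalso
    have h1 : weight Ω' δ x y {γ'} ≤ Z' := measure_mono (subset_univ _)
    rw [hZ'0, weight_singleton, nonpos_iff_eq_zero, ENNReal.ofReal_eq_zero] at h1
    exact absurd h1 (not_le.2 (pow_pos criticalFugacity_pos_lt_one'.1 _))
  · have key : Z'⁻¹ * ENNReal.ofReal (criticalFugacity ^ γ'.length) * (Z⁻¹ * Z') =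
        Z⁻¹ * ENNReal.ofReal (criticalFugacity ^ γ'.length) := by
      calc Z'⁻¹ * ENNReal.ofReal (criticalFugacity ^ γ'.length) * (Z⁻¹ * Z')
          = Z⁻¹ * ENNReal.ofReal (criticalFugacity ^ γ'.length) * (Z'⁻¹ * Z') := by ring
        _ = Z⁻¹ * ENNReal.ofReal (criticalFugacity ^ γ'.length) := by
            rw [ENNReal.inv_mul_cancel hZ'0 hZ'top, mul_one]
    calc (Z'⁻¹ * ENNReal.ofReal (criticalFugacity ^ γ'.length)).toReal * f γ'.curve *
          (Z⁻¹ * Z').toReal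
        = (Z'⁻¹ * ENNReal.ofReal (criticalFugacity ^ γ'.length) * (Z⁻¹ * Z')).toReal *
            f γ'.curve := by simp only [ENNReal.toReal_mul]; ring
      _ = (Z⁻¹ * ENNReal.ofReal (criticalFugacity ^ γ'.length)).toReal * f γ'.curve := by
            rw [key]

end Summit.CriticalPhenomena.SAWScalingLimit.Cruxes.BoundaryWard.ExactRestrictionProof

namespace Summit.CriticalPhenomena.SAWScalingLimit.Cruxes.BoundaryWard.ExactRestrictionProof

open MeasureTheory Filter Set
open scoped Topology ENNReal NNReal
open Literature.Probability.LatticeModels Literature.Probability.RandomPlanarGeometry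
open Literature.Probability.RandomPlanarGeometry.SAW

/-! ## Flow nesting (ODE uniqueness) -/

/-- A `C¹` vector field is Lipschitz on every closed ball. [folklore] -/
theorem exists_lipschitzOnWith_closedBall {u : ℂ → ℂ} (huc : ContDiff ℝ 2 u) (R : ℝ) :
    ∃ K : ℝ≥0, LipschitzOnWith K u (Metric.closedBall 0 R) := by
  have hcont : Continuous (fderiv ℝ u) := huc.continuous_fderiv (by norm_num)
  obtain ⟨C, hC⟩ := (isCompact_closedBall (0:ℂ) R).exists_bound_of_continuousOn hcont.continuousOn
  refine ⟨Real.toNNReal C, ?_⟩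
  refine Convex.lipschitzOnWith_of_nnnorm_fderiv_le (𝕜 := ℝ)
    (fun x _ => (huc.differentiable (by norm_num)).differentiableAt) (fun x hx => ?_)
    (convex_closedBall 0 R)
  have h := hC x hx
  rw [← NNReal.coe_le_coe, coe_nnnorm]
  exact h.trans (Real.le_coe_toNNReal C)

/-- **Flow nesting** (stub R1 of `PieceSkeletons.lean`, PROVED): the flow of a `C²` field on `D̄`
mapping `D` into itself satisfies `g_{s+h}(z) = g_s(g_h(z))` for `z ∈ D` (uniqueness of solutions,
`u` being Lipschitz on a ball containing the bounded `D`), hence `g_{s+h}(D) ⊆ g_s(D)`. [folklore] -/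
theorem flowNesting :
    ∀ (D : Literature.Probability.RandomPlanarGeometry.DobrushinDomain) (u : ℂ → ℂ), ContDiff ℝ 2 u → ∀ (g : ℝ → ℂ → ℂ) (t₀ : ℝ), 0 < t₀ → (∀ z, g 0 z = z) → (∀ t ∈ Set.Icc (0 : ℝ) t₀, ∀ z ∈ closure D.carrier, HasDerivAt (fun r => g r z) (u (g t z)) t) → (∀ t ∈ Set.Icc (0 : ℝ) t₀, g t '' D.carrier ⊆ D.carrier) → ∀ s h : ℝ, 0 ≤ s → 0 ≤ h → s + h ≤ t₀ → g (s + h) '' D.carrier ⊆ g s '' D.carrier := by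
  intro D u huc g t₀ ht₀ hg0 hgd hgD s h hs hh hsh
  rintro _ ⟨z, hz, rfl⟩
  -- the ball containing `D`
  obtain ⟨R, hR⟩ := (Metric.isBounded_iff_subset_closedBall (0:ℂ)).1 D.isBounded
  obtain ⟨K, hK⟩ := exists_lipschitzOnWith_closedBall huc R
  have hgDmem : ∀ t ∈ Set.Icc (0:ℝ) t₀, ∀ w ∈ D.carrier, g t w ∈ D.carrier :=
    fun t ht w hw => hgD t ht ⟨w, hw, rfl⟩
  -- the two trajectories from `g h z`
  set φ₁ : ℝ → ℂ := fun r => g (h + r) z with hφ₁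
  set φ₂ : ℝ → ℂ := fun r => g r (g h z) with hφ₂
  have hhz : g h z ∈ D.carrier := hgDmem h ⟨hh, by linarith⟩ z hz
  have hd₁ : ∀ r ∈ Set.Icc (0:ℝ) s, HasDerivAt φ₁ (u (φ₁ r)) r := by
    intro r hr
    have hmem : h + r ∈ Set.Icc (0:ℝ) t₀ := ⟨by linarith [hr.1], by linarith [hr.2]⟩
    exact (hgd (h + r) hmem z (subset_closure hz)).comp_const_add h r
  have hd₂ : ∀ r ∈ Set.Icc (0:ℝ) s, HasDerivAt φ₂ (u (φ₂ r)) r := by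
    intro r hr
    exact hgd r ⟨hr.1, by linarith [hr.2]⟩ (g h z) (subset_closure hhz)
  have heq : EqOn φ₁ φ₂ (Set.Icc 0 s) := by
    refine ODE_solution_unique_of_mem_Icc_right (v := fun _ => u) (s := fun _ => Metric.closedBall 0 R)
      (K := K) (fun _ _ => hK)
      (fun r hr => (hd₁ r hr).continuousAt.continuousWithinAt)
      (fun r hr => (hd₁ r (Ico_subset_Icc_self hr)).hasDerivWithinAt)
      (fun r hr => hR (hgDmem (h + r) ⟨by linarith [hr.1], by linarith [hr.2]⟩ z hz))
      (fun r hr => (hd₂ r hr).continuousAt.continuousWithinAt)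
      (fun r hr => (hd₂ r (Ico_subset_Icc_self hr)).hasDerivWithinAt)
      (fun r hr => hR (hgDmem r ⟨hr.1, by linarith [hr.2]⟩ (g h z) hhz)) ?_
    show g (h + 0) z = g 0 (g h z)
    rw [add_zero, hg0]
  have key : g (s + h) z = g s (g h z) := by
    have := heq ⟨hs, le_rfl⟩
    simp only [hφ₁, hφ₂] at this
    rw [add_comm] at this
    exact this
  exact ⟨g h z, hhz, key.symm⟩

end Summit.CriticalPhenomena.SAWScalingLimit.Cruxes.BoundaryWard.ExactRestrictionProof

namespace Summit.CriticalPhenomena.SAWScalingLimit.Cruxes.BoundaryWard.ExactRestrictionProof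

open MeasureTheory Filter Set
open scoped Topology ENNReal
open Literature.Probability.LatticeModels Literature.Probability.RandomPlanarGeometry
open Literature.Probability.RandomPlanarGeometry.SAW

/-- Joined endpoints: either the start lies in the discrete domain or the two endpoints coincide.
[folklore] -/
theorem mem_meshDomain_or_eq_of_reachable {Ω : Set ℂ} {δ : ℝ} {x y : Site 2}
    (h : (discreteDomainGraph Ω δ).Reachable x y) : x ∈ meshDomain Ω δ ∨ x = y := by
  obtain ⟨p⟩ := h
  cases p with
  | nil => exact Or.inr rfl
  | cons hadj _ => exact Or.inl (discreteDomainGraph_adj_iff.1 hadj).2.1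

/-- **`ExactRestriction` (the support child of the split of `BoundaryWard`), PROVED.**
[cite: LawlerSchrammWerner2004SAW, §3.4.5] -/
theorem exactRestriction :
    ∀ (D : Literature.Probability.RandomPlanarGeometry.DobrushinDomain) (a b : ℝ → Literature.Probability.LatticeModels.Site 2), Literature.Probability.RandomPlanarGeometry.SAW.IsEndpointApprox D a b → let P := fun (Ω : Set ℂ) (δ : ℝ) => Literature.Probability.RandomPlanarGeometry.SAW.law Ω δ (a δ) (b δ); ∀ (u : ℂ → ℂ) (U : Set ℂ), IsOpen U → closure D.carrier ⊆ U → DifferentiableOn ℂ u U → ContDiff ℝ 2 u → u (D.pt 0) = 0 → u (D.pt 1) = 0 → ∀ (g : ℝ → ℂ → ℂ) (hg : ∀ t, Continuous (g t)) (t₀ : ℝ), 0 < t₀ → (∀ z, g 0 z = z) → (∀ t, ∃ K, LipschitzWith K (g t)) → (∀ t ∈ Set.Icc (0 : ℝ) t₀, ∀ z ∈ closure D.carrier, HasDerivAt (fun r => g r z) (u (g t z)) t) → (∀ t ∈ Set.Icc (0 : ℝ) t₀, g t '' D.carrier ⊆ D.carrier) → (∀ t ∈ Set.Icc (0 : ℝ)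 t₀, ∀ᶠ δ in nhdsWithin 0 (Set.Ioi 0), (Literature.Probability.LatticeModels.discreteDomainGraph (g t '' D.carrier) δ).Reachable (a δ) (b δ)) → ∀ f : BoundedContinuousFunction (Literature.Probability.RandomPlanarGeometry.CurveClass ℂ) ℝ, ∀ s ∈ Set.Icc (0 : ℝ) t₀, ∀ h : ℝ, 0 < h → s + h ≤ t₀ → ∀ᶠ δ in nhdsWithin 0 (Set.Ioi 0), MeasureTheory.IsProbabilityMeasure (P (g s '' D.carrier) δ) ∧ (∫ γ, f γ.curve ∂(P (g (s + h) '' D.carrier) δ)) * ((P (g s '' D.carrier) δ) {γ | ∃ γ' : Literature.Probability.RandomPlanarGeometry.SAW.DomainSAW (g (s + h) '' D.carrier) δ (a δ) (b δ), γ'.walk.support = γ.walk.support}).toReal = ∫ γ in {γ | ∃ γ' : Literature.Probability.RandomPlanarGeometry.SAW.DomainSAW (g (s + h) '' D.carrier) δ (a δ) (b δ), γ'.walk.support = γ.walk.support}, f γ.curve ∂(P (g s '' D.carrier) δ) := by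
  intro D a b hab P u U hU hDU hud huc hua hub g hg t₀ ht₀ hg0 hgL hgd hgD hreach f s hs h hh hsh
  have hnest : g (s + h) '' D.carrier ⊆ g s '' D.carrier :=
    flowNesting D u huc g t₀ ht₀ hg0 hgd hgD s h hs.1 hh.le hsh
  have hbdd : Bornology.IsBounded (g s '' D.carrier) := D.isBounded.subset (hgD s hs)
  filter_upwards [hreach s hs, self_mem_nhdsWithin] with δ hr hδ
  have hN := walkNesting (g s '' D.carrier) (g (s + h) '' D.carrier) δ (a δ) (b δ) hnest
    (mem_meshDomain_or_eq_of_reachable hr)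
  exact restrictionIntegral (g s '' D.carrier) (g (s + h) '' D.carrier) δ (a δ) (b δ) hbdd hδ hr hN f

end Summit.CriticalPhenomena.SAWScalingLimit.Cruxes.BoundaryWard.ExactRestrictionProof
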